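import Summits.AtomisticToContinuum.FouriersLaw.Theorems.BondHeatUncertaintyExtensiveSnapshotIrreversibilityOddLogDensitySandwichAux1
import Summits.AtomisticToContinuum.FouriersLaw.Theorems.BondHeatUncertaintyExtensiveSnapshotIrreversibilityOddLogDensitySandwichAux2
import HarnessLib

/-!
# Crux `ExtensiveSnapshotIrreversibility` (stmt-AtomisticToContinuum-9121), line `hellinger-logmean`:
stub S_H1 `stub_oddLogDensitySandwich` — helper file 3 (S_H1 from its two analytic inputs, verbatim shape)

The registered stub S_H1 of the lead's checked skeleton v3 asks, for the two-temperature steady states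
`μ_δ = μ_{N,T+δ/2,T−δ/2}` of the pinned anharmonic chain `P = pinnedChain ω₂ lam β γ`, for EVERY `η > 0`, a
window `δ₀ > 0` and a positive measurable probability-density family `ρ_δ` of `μ_δ` with the ODD envelope
`|log ρ_δ − log ρ_δ∘Θ| ≤ 2η(1 + H)` everywhere (`Θ(q, p) = (q, −p)`).

This file states the EXACT residual of S_H1 after the landed assembly (helper files 1–2): the conclusion of S_H1,
in its verbatim shape, follows from ONE analytic hypothesis on continuous positive Lebesgue-density families of
the steady states near `δ = 0` —

  (TwoSided ∧ Equi): for every `η' > 0` a `δ`-UNIFORM two-sided Gibbs sandwich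
  `c e^{−(1/T+η')H} ≤ ρ_δ ≤ C e^{−(1/T−η')H}` on a punctured window (`NessLogDensityTwoSided`; lower half not in
  print for any heat-conduction chain at fixed temperatures, upper half printed only as exponential MOMENTS —
  Cuneo–Eckmann–Hairer–Rey-Bellet 2018 Thm 2.13 (2) — or, pointwise, for the EPR reservoir model —
  Eckmann–Pillet–Rey-Bellet 1999a §3), AND `δ`-uniform equicontinuity of `(ρ_δ)` on every energy sublevel set
  (a quantitative, parameter-uniform form of Hörmander's theorem; the tree's is qualitative) —

because continuous versions of a Lebesgue density are unique, so the hypothesis may be consumed by the CANONICAL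
smooth positive family of `helper_oddSandwichDensityFamily` (helper file 1), after which
`helper_oddSandwichLocalOfEquicontinuous` (helper file 2: equicontinuity + the landed pointwise limit ⇒ local
smallness of the odd log-ratio) and `helper_oddSandwichOfTwoSided` (helper file 1: far/near split) conclude.

* `helper_oddSandwichOfInputs` (registered helper) — the statement just described.

References: recon memo `work/stubs/S_H1-recon.md`; L. Rey-Bellet, L. E. Thomas, CMP 215 (2000), Thm 1.4,
Remark 1.5; J.-P. Eckmann, C.-A. Pillet, L. Rey-Bellet, CMP 201 (1999), §3; N. Cuneo, J.-P. Eckmann, M. Hairer,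
L. Rey-Bellet, EJP 23 (2018) no. 55, Thm 2.13.
-/

noncomputable section

namespace Summit.AtomisticToContinuum.FouriersLaw.Theorems.ExtensiveSnapshotIrreversibility.HellingerLogMean

open MeasureTheory Filter Topology Set Metric
open scoped ENNReal NNReal
open Literature.MathematicalPhysics.KineticTheory.HeatConduction
open Summit.AtomisticToContinuum.FouriersLaw.Theorems.ExtensiveSnapshotIrreversibility.ClausiusBudget

/-- **S_H1 from (TwoSided ∧ Equi), verbatim shape** (registered helper `helper_oddSandwichOfInputs`, line
`hellinger-logmean`). Along every steady-state family `μ` of the pinned chain (all parameters `> 0`), `T > 0`,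
`N ≥ 1`: IF every continuous, everywhere positive Lebesgue-density family `ρ` of the steady states
`μ_{N,T+δ/2,T−δ/2}`, `|δ| < 2T`, admits (i) for every `η' > 0` a `δ`-uniform two-sided Gibbs sandwich
`c e^{−(1/T+η')H} ≤ ρ_δ ≤ C e^{−(1/T−η')H}` on a punctured window and (ii) `δ`-uniform equicontinuity on every
energy sublevel set eventually in `δ ≠ 0`, THEN the conclusion of S_H1 holds: for every `η > 0` there are `δ₀ > 0`
and a measurable positive density family with `μ_δ = ρ_δ·Leb`, `∫ρ_δ = 1` and
`|log ρ_δ(x) − log ρ_δ(Θx)| ≤ 2η(1 + H(x))` for `0 < |δ| < δ₀`.  Canonical family (helper 1) + compact half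
(helper 2) + far/near assembly (helper 1). [folklore] -/
theorem helper_oddSandwichOfInputs :
    ∀ ω₂ lam β γ : ℝ, 0 < ω₂ → 0 < lam → 0 < β → 0 < γ →
      ∀ μ : (N : ℕ) → ℝ → ℝ → Measure (PhaseSpace N),
        (∀ (N : ℕ) (T_L T_R : ℝ), 0 < T_L → 0 < T_R →
          (pinnedChain ω₂ lam β γ).IsSteadyState N T_L T_R (μ N T_L T_R)) →
        ∀ T : ℝ, 0 < T → ∀ N : ℕ, 0 < N →
          (∀ ρ : ℝ → PhaseSpace N → ℝ, (∀ δ, Continuous (ρ δ)) → (∀ δ x, 0 < ρ δ x) →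
            (∀ δ : ℝ, |δ| < 2 * T → μ N (T + δ / 2) (T - δ / 2) =
              (volume : Measure (PhaseSpace N)).withDensity (fun x => ENNReal.ofReal (ρ δ x))) →
            (∀ η' : ℝ, 0 < η' → ∃ δ₁ c C : ℝ, 0 < δ₁ ∧ 0 < c ∧ ∀ δ : ℝ, δ ≠ 0 → |δ| < δ₁ →
              ∀ x : PhaseSpace N,
                c * Real.exp (-((1 / T + η') * (pinnedChain ω₂ lam β γ).hamiltonian N x)) ≤ ρ δ x ∧
                ρ δ x ≤ C * Real.exp (-((1 / T - η') * (pinnedChain ω₂ lam β γ).hamiltonian N x))) ∧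
            (∀ R ε : ℝ, 0 < ε → ∃ r : ℝ, 0 < r ∧ ∀ᶠ δ in 𝓝[≠] (0 : ℝ), ∀ x : PhaseSpace N,
              (pinnedChain ω₂ lam β γ).hamiltonian N x ≤ R →
                ∀ y ∈ Metric.ball x r, |ρ δ y - ρ δ x| ≤ ε)) →
          ∀ η : ℝ, 0 < η →
            ∃ δ₀ : ℝ, 0 < δ₀ ∧ ∃ ρ : ℝ → PhaseSpace N → ℝ,
              (∀ δ, Measurable (ρ δ)) ∧ (∀ δ x, 0 < ρ δ x) ∧
              ∀ δ : ℝ, δ ≠ 0 → |δ| < δ₀ →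
                μ N (T + δ / 2) (T - δ / 2) =
                  (volume : Measure (PhaseSpace N)).withDensity (fun x => ENNReal.ofReal (ρ δ x)) ∧
                (∫⁻ x, ENNReal.ofReal (ρ δ x) ∂(volume : Measure (PhaseSpace N))) = 1 ∧
                ∀ x : PhaseSpace N, |Real.log (ρ δ x) - Real.log (ρ δ (x.1, -x.2))| ≤
                  2 * (η * (1 + (pinnedChain ω₂ lam β γ).hamiltonian N x)) := by
  intro ω₂ lam β γ hω hl hβ hγ μ hμ T hT N hN hinputs η hη
  -- the canonical smooth positive density family
  obtain ⟨ρ, hρs, hρm, hρpos, hρrep⟩ :=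
    helper_oddSandwichDensityFamily ω₂ lam β γ hω hl hβ hγ μ hμ T hT N hN
  have hrep2T : ∀ δ : ℝ, |δ| < 2 * T → μ N (T + δ / 2) (T - δ / 2) =
      (volume : Measure (PhaseSpace N)).withDensity (fun x => ENNReal.ofReal (ρ δ x)) :=
    fun δ hδ => (hρrep δ hδ).1
  -- the two analytic inputs for this family
  obtain ⟨hsand, hequi⟩ := hinputs ρ (fun δ => (hρs δ).continuous) hρpos hrep2T
  -- representation on punctured windows / eventually
  have hrepw : ∃ δ₁ : ℝ, 0 < δ₁ ∧ ∀ δ : ℝ, δ ≠ 0 → |δ| < δ₁ → μ N (T + δ / 2) (T - δ / 2) =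
      (volume : Measure (PhaseSpace N)).withDensity (fun x => ENNReal.ofReal (ρ δ x)) :=
    ⟨2 * T, by positivity, fun δ _ hδ => hrep2T δ hδ⟩
  have hrepev : ∀ᶠ δ in 𝓝[≠] (0 : ℝ), μ N (T + δ / 2) (T - δ / 2) =
      (volume : Measure (PhaseSpace N)).withDensity (fun x => ENNReal.ofReal (ρ δ x)) := by
    have h1 : ∀ᶠ δ in 𝓝 (0 : ℝ), |δ| < 2 * T := by
      have : Metric.ball (0 : ℝ) (2 * T) ∈ 𝓝 (0 : ℝ) := Metric.ball_mem_nhds 0 (by positivity)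
      filter_upwards [this] with δ hδ
      simpa [Real.dist_eq] using hδ
    exact (h1.filter_mono nhdsWithin_le_nhds).mono fun δ hδ => hrep2T δ hδ
  -- the compact half from equicontinuity, then the far/near assembly
  have hloc := helper_oddSandwichLocalOfEquicontinuous ω₂ lam β γ hω hl hβ hγ μ hμ T hT N hN ρ hρm hρpos
    hrepev hequi
  obtain ⟨δ₀, hδ₀, hconcl⟩ := helper_oddSandwichOfTwoSided ω₂ lam β γ hω hl hβ hγ μ hμ T hT N ρ hρm hρpos
    hrepw hsand hloc η hη
  exact ⟨δ₀, hδ₀, ρ, hρm, hρpos, hconcl⟩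

end Summit.AtomisticToContinuum.FouriersLaw.Theorems.ExtensiveSnapshotIrreversibility.HellingerLogMean

end
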